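import Mathlib
import HarnessLib
import Summits.NavierStokesRegularity.NavierStokesRegularity.Theorems.UnthreadedDoorCellFluxDefs
import Literature.Analysis.Calculus.RealAnalyticSignSetFiniteness

/-!
# Route `UnthreadedDoor`, crux `PoloidalLiouville` (stmt-NavierStokesRegularity-1222), WALL W1 — crux idea «indicatrix-bound», Λ-geo‴ (part 1):
# near the centre, the regular parts `S_a ∖ sphCrit` of the slices of a jointly analytic unthreaded field have uniformly finitely many components

★ `componentsBounded_nearCentre_of : <F2 `BierstoneMilman1988_fibre_components_bounded` body verbatim> → (for `v` jointly analytic on the window slab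
with the link `curl (v t) = ∇(T t) × (· − x₀)`) ∃ N, ∀ t ∈ [t₁,t₂], ∀ a ∈ (0,1), the connected components of `S_a(x₀) ∖ sphCrit (T t) x₀ a` are finite and
at most `N` in number` — the F2 instantiation of the custodian's Λ-geo‴ recipe (`Cruxes/PoloidalLiouville/IndicatrixSketch.lean` v1.7.3, decl
`AnalyticCellCountNearCentre`): `m := 2`, `P := {p | p 0 ∈ Ioo t₀ 0}`, `U := univ`, box `Icc ![t₁, 0] ![t₂, 1]`, `H (p, x) := ‖x − x₀‖² − (p 1)²`,
`G (p, x) := ‖curl (v (p 0)) x‖²` (jointly analytic: the total derivative of `uncurry v` is analytic, the slice derivative is its composition with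
`inr`, and `curl` is a fixed linear map of the derivative), compactness = closed and bounded in `(Fin 2 → ℝ) × E3`, and by the link the F2 fibre
`{H = 0 ∧ G ≠ 0}` over `p = ![t, a]` IS `S_a ∖ sphCrit (T t) x₀ a` (no regularity of `T` needed).  Part 2 (the counting step «cells ≤ components of the
regular part», shared with ARM A g8's Λ-geo F1-bridge) turns this into `AnalyticCellCountNearCentre`.  Also ★ `componentsBounded_nearCentre_of_realAnExp` —
the same modulo the ONE standing fact `VandendriesMiller1994_realAnExp_isOMinimal` (F2 = p710694 by name).  Pure analytic bookkeeping; nothing here is an NS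
statement; ⟨1222⟩ / W1 / NS regularity OPEN.  `--supports stmt-NavierStokesRegularity-1222 --as helper`.  [folklore]
-/

noncomputable section

-- the summit and its single sub-problem share the name (CONVENTIONS §1)
set_option linter.dupNamespace false

open Set Function Filter Topology MeasureTheory InnerProductSpace
open scoped RealInnerProductSpace

namespace Summit.NavierStokesRegularity.NavierStokesRegularity.Theorems.PoloidalLiouville.Indicatrix

open Summit.NavierStokesRegularity.NavierStokesRegularity.Theorems.PoloidalLiouville.NetFlux (E3)
open Summit.NavierStokesRegularity.NavierStokesRegularity.Theorems.PoloidalLiouville.CellFlux (sphCrit)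
open Literature.Analysis Literature.Analysis.FluidPDE

/-! ### Joint analyticity of the space-time vorticity on a window slab -/

/-- **`(t, x) ↦ curl (v t) x` is jointly analytic on `I × ℝ³` (`I` open) if `uncurry v` is**: the total derivative of `uncurry v` is analytic, the slice
derivative is its composition with `inr`, and `curl` is a fixed linear map of the derivative. [folklore] -/
theorem analyticOnNhd_curl_uncurry_of_isOpen {V : ℝ → E3 → E3} {I : Set ℝ} (hI : IsOpen I)
    (hV : AnalyticOnNhd ℝ (uncurry V) (I ×ˢ (univ : Set E3))) :
    AnalyticOnNhd ℝ (fun p : ℝ × E3 => curl (V p.1) p.2) (I ×ˢ (univ : Set E3)) := by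
  -- the curl read off a linear map `A : ℝ³ →L ℝ³`, as a (continuous) linear map of `A`
  let curlL : (E3 →L[ℝ] E3) →ₗ[ℝ] E3 :=
    { toFun := fun A => WithLp.toLp 2 ![A (EuclideanSpace.single 1 1) 2 - A (EuclideanSpace.single 2 1) 1,
        A (EuclideanSpace.single 2 1) 0 - A (EuclideanSpace.single 0 1) 2,
        A (EuclideanSpace.single 0 1) 1 - A (EuclideanSpace.single 1 1) 0]
      map_add' := fun A B => by
        ext i
        fin_cases i <;> simp <;> ring
      map_smul' := fun c A => by
        ext i
        fin_cases i <;> simp <;> ring }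
  let Lc : (E3 →L[ℝ] E3) →L[ℝ] E3 := LinearMap.toContinuousLinearMap curlL
  have hcurl : ∀ (u : E3 → E3) (x : E3), curl u x = Lc (fderiv ℝ u x) := fun u x => by
    simp only [Lc, LinearMap.coe_toContinuousLinearMap']
    rfl
  have hopen : IsOpen (I ×ˢ (univ : Set E3)) := hI.prod isOpen_univ
  have hD : AnalyticOnNhd ℝ (fderiv ℝ (uncurry V)) (I ×ˢ (univ : Set E3)) := hV.fderiv
  set L : (ℝ × E3 →L[ℝ] E3) →L[ℝ] E3 :=
    Lc.comp ((ContinuousLinearMap.compL ℝ E3 (ℝ × E3) E3).flip (ContinuousLinearMap.inr ℝ ℝ E3)) with hL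
  have hLA : AnalyticOnNhd ℝ (fun p => L (fderiv ℝ (uncurry V) p)) (I ×ˢ (univ : Set E3)) :=
    L.comp_analyticOnNhd hD
  refine hLA.congr hopen ?_
  rintro p hp
  have hdiff : DifferentiableAt ℝ (uncurry V) p := (hV p hp).differentiableAt
  have hslice : fderiv ℝ (V p.1) p.2 = (fderiv ℝ (uncurry V) p).comp (ContinuousLinearMap.inr ℝ ℝ E3) := by
    have hinr : HasFDerivAt (fun y : E3 => ((p.1, y) : ℝ × E3)) (ContinuousLinearMap.inr ℝ ℝ E3) p.2 := hasFDerivAt_prodMk_right p.1 p.2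
    have hcomp := hdiff.hasFDerivAt.comp p.2 hinr
    exact hcomp.fderiv
  show L (fderiv ℝ (uncurry V) p) = curl (V p.1) p.2
  rw [hcurl, hslice, hL]
  simp [ContinuousLinearMap.compL]

/-- `y ↦ ‖y‖²` is real-analytic on `E3` (a finite sum of squares of coordinate functionals). [folklore] -/
theorem analyticOnNhd_norm_sq_E3 : AnalyticOnNhd ℝ (fun y : E3 => ‖y‖ ^ 2) univ := by
  have hcoord : ∀ i : Fin 3, AnalyticOnNhd ℝ (fun y : E3 => y i) univ := fun i =>
    (EuclideanSpace.proj i : E3 →L[ℝ] ℝ).analyticOnNhd _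
  have heq : (fun y : E3 => ‖y‖ ^ 2) = fun y => ∑ i, y i * y i := by
    funext y
    rw [EuclideanSpace.norm_eq, Real.sq_sqrt (Finset.sum_nonneg fun i _ => sq_nonneg _)]
    exact Finset.sum_congr rfl fun i _ => by rw [Real.norm_eq_abs, sq_abs, sq]
  rw [heq]
  exact Finset.analyticOnNhd_fun_sum _ fun i _ => (hcoord i).mul (hcoord i)

/-! ### The F2 instantiation -/

/-- ★ **Λ-geo‴, part 1 (F2 instantiation): the regular parts of the near-centre sphere slices have uniformly finitely many components.**  For `v` jointly
analytic on `]t₀,0[ × ℝ³` with the link `curl (v t) = ∇(T t) × (· − x₀)` and `t₀ < t₁ ≤ t₂ < 0`, F2 (the body of `BierstoneMilman1988_fibre_components_bounded`,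
verbatim) gives `N` with: for all `t ∈ [t₁,t₂]` and `a ∈ (0,1)`, the connected components of `S_a(x₀) ∖ sphCrit (T t) x₀ a` form a finite set of cardinality
`≤ N`. [folklore] -/
theorem componentsBounded_nearCentre_of
    (hF2 : ∀ (m : ℕ) (E : Type) [NormedAddCommGroup E] [NormedSpace ℝ E] [FiniteDimensional ℝ E]
      (P : Set (Fin m → ℝ)) (U : Set E) (a b : Fin m → ℝ) (H G : (Fin m → ℝ) × E → ℝ),
      IsOpen P → IsOpen U → Set.Icc a b ⊆ P → AnalyticOnNhd ℝ H (P ×ˢ U) → AnalyticOnNhd ℝ G (P ×ˢ U) →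
      IsCompact {q : (Fin m → ℝ) × E | q.1 ∈ Set.Icc a b ∧ q.2 ∈ U ∧ H q = 0} →
        ∃ N : ℕ, ∀ p ∈ Set.Icc a b,
          (connectedComponentIn {x | x ∈ U ∧ H (p, x) = 0 ∧ G (p, x) = 0} '' {x | x ∈ U ∧ H (p, x) = 0 ∧ G (p, x) = 0}).Finite ∧
          (connectedComponentIn {x | x ∈ U ∧ H (p, x) = 0 ∧ G (p, x) = 0} '' {x | x ∈ U ∧ H (p, x) = 0 ∧ G (p, x) = 0}).ncard ≤ N ∧
          (connectedComponentIn {x | x ∈ U ∧ H (p, x) = 0 ∧ G (p, x) ≠ 0} '' {x | x ∈ U ∧ H (p, x) = 0 ∧ G (p, x) ≠ 0}).Finite ∧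
          (connectedComponentIn {x | x ∈ U ∧ H (p, x) = 0 ∧ G (p, x) ≠ 0} '' {x | x ∈ U ∧ H (p, x) = 0 ∧ G (p, x) ≠ 0}).ncard ≤ N)
    (v : ℝ → E3 → E3) (x₀ : E3) (T : ℝ → E3 → ℝ) (t₀ t₁ t₂ : ℝ) (h01 : t₀ < t₁) (_h12 : t₁ ≤ t₂) (h20 : t₂ < 0)
    (hv : AnalyticOnNhd ℝ (uncurry v) (Ioo t₀ 0 ×ˢ (univ : Set E3)))
    (hlink : ∀ t ∈ Ioo t₀ 0, ∀ x, curl (v t) x = cross (gradient (T t) x) (x - x₀)) :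
    ∃ N : ℕ, ∀ t ∈ Icc t₁ t₂, ∀ a ∈ Ioo (0 : ℝ) 1,
      (connectedComponentIn (Metric.sphere x₀ a \ sphCrit (T t) x₀ a) '' (Metric.sphere x₀ a \ sphCrit (T t) x₀ a)).Finite ∧
      (connectedComponentIn (Metric.sphere x₀ a \ sphCrit (T t) x₀ a) '' (Metric.sphere x₀ a \ sphCrit (T t) x₀ a)).ncard ≤ N := by
  -- the data of F2
  set P : Set (Fin 2 → ℝ) := {p | p 0 ∈ Ioo t₀ 0} with hP
  set lo : Fin 2 → ℝ := ![t₁, 0] with hlo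
  set hi : Fin 2 → ℝ := ![t₂, 1] with hhi
  set H : (Fin 2 → ℝ) × E3 → ℝ := fun q => ‖q.2 - x₀‖ ^ 2 - (q.1 1) ^ 2 with hH
  set G : (Fin 2 → ℝ) × E3 → ℝ := fun q => ‖curl (v (q.1 0)) q.2‖ ^ 2 with hG
  have hPo : IsOpen P := (isOpen_Ioo.preimage (continuous_apply 0))
  have hbox : Icc lo hi ⊆ P := by
    intro p hp
    have h0 : lo 0 ≤ p 0 ∧ p 0 ≤ hi 0 := ⟨hp.1 0, hp.2 0⟩
    simp only [hlo, hhi, Matrix.cons_val_zero] at h0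
    exact ⟨lt_of_lt_of_le h01 h0.1, lt_of_le_of_lt h0.2 h20⟩
  -- analyticity of `H`
  have hfst : AnalyticOnNhd ℝ (fun q : (Fin 2 → ℝ) × E3 => q.1) (P ×ˢ (univ : Set E3)) :=
    (ContinuousLinearMap.fst ℝ (Fin 2 → ℝ) E3).analyticOnNhd _
  have hsnd : AnalyticOnNhd ℝ (fun q : (Fin 2 → ℝ) × E3 => q.2) (P ×ˢ (univ : Set E3)) :=
    (ContinuousLinearMap.snd ℝ (Fin 2 → ℝ) E3).analyticOnNhd _
  have hcoord : ∀ i : Fin 2, AnalyticOnNhd ℝ (fun q : (Fin 2 → ℝ) × E3 => q.1 i) (P ×ˢ (univ : Set E3)) := fun i =>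
    ((ContinuousLinearMap.proj i : (Fin 2 → ℝ) →L[ℝ] ℝ).comp (ContinuousLinearMap.fst ℝ (Fin 2 → ℝ) E3)).analyticOnNhd _
  have hHan : AnalyticOnNhd ℝ H (P ×ˢ (univ : Set E3)) := by
    have h1 : AnalyticOnNhd ℝ (fun q : (Fin 2 → ℝ) × E3 => ‖q.2 - x₀‖ ^ 2) (P ×ˢ (univ : Set E3)) :=
      analyticOnNhd_norm_sq_E3.comp (hsnd.sub analyticOnNhd_const) fun _ _ => mem_univ _
    exact h1.sub ((hcoord 1).pow 2)
  -- analyticity of `G`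
  have hGan : AnalyticOnNhd ℝ G (P ×ˢ (univ : Set E3)) := by
    have hω := analyticOnNhd_curl_uncurry_of_isOpen isOpen_Ioo hv
    have hmap : AnalyticOnNhd ℝ (fun q : (Fin 2 → ℝ) × E3 => ((q.1 0, q.2) : ℝ × E3)) (P ×ˢ (univ : Set E3)) :=
      (hcoord 0).prod hsnd
    have hcomp : AnalyticOnNhd ℝ (fun q : (Fin 2 → ℝ) × E3 => curl (v (q.1 0)) q.2) (P ×ˢ (univ : Set E3)) :=
      hω.comp hmap fun q hq => ⟨hq.1, mem_univ _⟩
    exact analyticOnNhd_norm_sq_E3.comp hcomp fun _ _ => mem_univ _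
  -- compactness of `{(p, x) : p ∈ box, H (p, x) = 0}`
  have hK : IsCompact {q : (Fin 2 → ℝ) × E3 | q.1 ∈ Icc lo hi ∧ q.2 ∈ (univ : Set E3) ∧ H q = 0} := by
    have hHc : Continuous H := by
      rw [hH]; fun_prop
    have hclosed : IsClosed {q : (Fin 2 → ℝ) × E3 | q.1 ∈ Icc lo hi ∧ q.2 ∈ (univ : Set E3) ∧ H q = 0} := by
      have h1 : IsClosed {q : (Fin 2 → ℝ) × E3 | q.1 ∈ Icc lo hi} := isClosed_Icc.preimage continuous_fst
      have h2 : IsClosed {q : (Fin 2 → ℝ) × E3 | H q = 0} := isClosed_eq hHc continuous_const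
      have heq : {q : (Fin 2 → ℝ) × E3 | q.1 ∈ Icc lo hi ∧ q.2 ∈ (univ : Set E3) ∧ H q = 0}
          = {q : (Fin 2 → ℝ) × E3 | q.1 ∈ Icc lo hi} ∩ {q : (Fin 2 → ℝ) × E3 | H q = 0} := by
        ext q; simp only [mem_setOf_eq, mem_univ, true_and, mem_inter_iff]
      rw [heq]
      exact h1.inter h2
    have hsub : {q : (Fin 2 → ℝ) × E3 | q.1 ∈ Icc lo hi ∧ q.2 ∈ (univ : Set E3) ∧ H q = 0} ⊆
        Icc lo hi ×ˢ Metric.closedBall x₀ 1 := by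
      rintro ⟨p, x⟩ ⟨hp, -, hq⟩
      refine ⟨hp, ?_⟩
      have h1 : lo 1 ≤ p 1 ∧ p 1 ≤ hi 1 := ⟨hp.1 1, hp.2 1⟩
      simp only [hlo, hhi, Matrix.cons_val_one, Matrix.cons_val_fin_one] at h1
      have hsq : ‖x - x₀‖ ^ 2 = (p 1) ^ 2 := by
        have : ‖x - x₀‖ ^ 2 - (p 1) ^ 2 = 0 := hq
        linarith
      have hle : ‖x - x₀‖ ^ 2 ≤ 1 := by rw [hsq]; nlinarith [h1.1, h1.2]
      rw [Metric.mem_closedBall, dist_eq_norm]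
      nlinarith [norm_nonneg (x - x₀), hle]
    exact ((isCompact_Icc.prod (isCompact_closedBall x₀ 1)).of_isClosed_subset hclosed hsub)
  obtain ⟨N, hN⟩ := hF2 2 E3 P univ lo hi H G hPo isOpen_univ hbox hHan hGan hK
  refine ⟨N, fun t ht a ha => ?_⟩
  -- the fibre over `p = ![t, a]`
  set p : Fin 2 → ℝ := ![t, a] with hp
  have hpbox : p ∈ Icc lo hi := by
    constructor
    · intro i; fin_cases i
      · simpa [hp, hlo] using ht.1
      · simpa [hp, hlo] using ha.1.le
    · intro i; fin_cases i
      · simpa [hp, hhi] using ht.2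
      · simpa [hp, hhi] using ha.2.le
  have htW : t ∈ Ioo t₀ 0 := ⟨lt_of_lt_of_le h01 ht.1, lt_of_le_of_lt ht.2 h20⟩
  have hfib : {x : E3 | x ∈ (univ : Set E3) ∧ H (p, x) = 0 ∧ G (p, x) ≠ 0} = Metric.sphere x₀ a \ sphCrit (T t) x₀ a := by
    ext x
    have hHx : H (p, x) = ‖x - x₀‖ ^ 2 - a ^ 2 := by
      simp only [hH, hp, Matrix.cons_val_one, Matrix.cons_val_fin_one]
    have hGx : G (p, x) = ‖curl (v t) x‖ ^ 2 := by
      simp only [hG, hp, Matrix.cons_val_zero]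
    have hsph : ‖x - x₀‖ ^ 2 - a ^ 2 = 0 ↔ x ∈ Metric.sphere x₀ a := by
      rw [mem_sphere_iff_norm, sub_eq_zero]
      exact pow_left_inj₀ (norm_nonneg _) ha.1.le two_ne_zero
    have hcrit : x ∈ Metric.sphere x₀ a → (‖curl (v t) x‖ ^ 2 ≠ 0 ↔ x ∉ sphCrit (T t) x₀ a) := fun hx => by
      rw [sphCrit, mem_setOf_eq, ← hlink t htW x]
      constructor
      · rintro h1 ⟨-, h2⟩
        apply h1
        rw [h2, norm_zero]
        ring
      · intro h1 h2
        exact h1 ⟨hx, norm_eq_zero.1 ((pow_eq_zero_iff two_ne_zero).1 h2)⟩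
    rw [mem_setOf_eq, Set.mem_sdiff, hHx, hGx, hsph]
    constructor
    · rintro ⟨-, hx, h2⟩
      exact ⟨hx, (hcrit hx).1 h2⟩
    · rintro ⟨hx, hx'⟩
      exact ⟨mem_univ _, hx, (hcrit hx).2 hx'⟩
  obtain ⟨-, -, h3, h4⟩ := hN p hpbox
  rw [hfib] at h3 h4
  exact ⟨h3, h4⟩

/-- ★ **Λ-geo‴, part 1, modulo the one standing fact**: with the o-minimality of `ℝ_an,exp` (`VandendriesMiller1994_realAnExp_isOMinimal`), F2 is the landed
theorem `Literature.Analysis.Calculus.analyticSignSet_fibre_connectedComponents_bounded_of_realAnExp_isOMinimal` (p710694). [folklore] -/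
theorem componentsBounded_nearCentre_of_realAnExp
    (hO : Literature.ModelTheory.ExponentialFields.VandendriesMiller1994_realAnExp_isOMinimal)
    (v : ℝ → E3 → E3) (x₀ : E3) (T : ℝ → E3 → ℝ) (t₀ t₁ t₂ : ℝ) (h01 : t₀ < t₁) (h12 : t₁ ≤ t₂) (h20 : t₂ < 0)
    (hv : AnalyticOnNhd ℝ (uncurry v) (Ioo t₀ 0 ×ˢ (univ : Set E3)))
    (hlink : ∀ t ∈ Ioo t₀ 0, ∀ x, curl (v t) x = cross (gradient (T t) x) (x - x₀)) :
    ∃ N : ℕ, ∀ t ∈ Icc t₁ t₂, ∀ a ∈ Ioo (0 : ℝ) 1,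
      (connectedComponentIn (Metric.sphere x₀ a \ sphCrit (T t) x₀ a) '' (Metric.sphere x₀ a \ sphCrit (T t) x₀ a)).Finite ∧
      (connectedComponentIn (Metric.sphere x₀ a \ sphCrit (T t) x₀ a) '' (Metric.sphere x₀ a \ sphCrit (T t) x₀ a)).ncard ≤ N :=
  componentsBounded_nearCentre_of
    (Literature.Analysis.Calculus.analyticSignSet_fibre_connectedComponents_bounded_of_realAnExp_isOMinimal hO)
    v x₀ T t₀ t₁ t₂ h01 h12 h20 hv hlink

end Summit.NavierStokesRegularity.NavierStokesRegularity.Theorems.PoloidalLiouville.Indicatrix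

end
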